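import Mathlib
import HarnessLib
import Literature.Analysis.FluidPDE.VorticityCalculus
import Summits.NavierStokesRegularity.NavierStokesRegularity.Theses.PoloidalWindowDoor
import Summits.NavierStokesRegularity.NavierStokesRegularity.Theses.LoopPeriodRatchet
import Summits.NavierStokesRegularity.NavierStokesRegularity.Theorems.PoloidalWindowDoorPoloidalWindowRigidityWindow
import Summits.NavierStokesRegularity.NavierStokesRegularity.Theorems.PoloidalWindowDoorPoloidalWindowRigidityHotLoopsReduction

/-!
# LINE 14 `loop_island` — PEAKLESS ⇒ LOOP-FREE, per profile; the wall ⟨27893⟩ is a SCALAR statement (ns-idea-8 g7, lens «barrier»)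

No summit is proved by any line; items 19708 / 20428 / 27893 / 22881 stay OPEN.  bears_on: LADDER-NS N0 (THICK column of crux K2
`PoloidalWindowRigidity`, stmt-NavierStokesRegularity-19708; (TH) twin stmt-…-20428) and the negation-first unit `cdisprove-27893` (KEY-NS #158 (1)).

STATE OF RECORD (hot_loops v4.3 + `Theorems/…HotLoopsReduction`, std axioms): 19708 / 20428 ⇐ S0 ∧ ⟨27893⟩ ∧ HL3′, where ⟨27893⟩
`LoopPeriodRatchet.FrequencyGrowthExponent` ⟺ NoLoops («no class e₃-poloidal profile carries a non-stationary closed vortex line»,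
`Lines/noloops_wall.lean`, kernel) and the LANDED `…HotLoopsReduction.zero_of_island` reads ⟨27893⟩ ⇒ NoIslands («a class e₃-poloidal profile
with an ISLAND BRACKET of `±v₂` on some horizontal plane at some time is `≡ 0`»).

THE LEVER (new): the converse NoIslands ⇒ NoLoops, PER PROFILE and WITHOUT the wall.  A non-stationary closed vortex line `Λ = range γ` of
`curl v(s)` lies in a horizontal plane `P` (poloidal) and `w := v₂(s,·)` is constant on it (frozen law `⟪Dv·ω, e₃⟫ = 0`).  (J) JORDAN: `Λ` bounds a
bounded planar region `Ω` with `∂_P Ω ⊆ Λ`.  (D) DISC DICHOTOMY: either `w ≢ w|_Λ` on `Ω` — then `argmax_{Ω̄} (±w)` with guard `Ω` IS an island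
bracket — or `w ≡ w|_Λ` on `Ω`, hence (real-analyticity of the slice) on the whole plane `P`: the plane is `w`-FLAT.  (Z) LOOPS PERSIST across
nearby planes at the same time (a compact regular level circle of the planar stream function survives a `C¹`-small change of the plane), so
either an island bracket appears on a nearby plane or a whole SLAB of planes is `w`-flat.  (Y) LAYERED RIGIDITY: `∇ₕw(s,·) ≡ 0` on a slab ⇒ on
`ℝ³` (analyticity) ⇒ per plane `vₕ(s,·,z)` is a bounded harmonic gradient with bounded derivative ⇒ `vₕ = b(z)` (Liouville) ⇒ `curl v(s) =
(−b₂′, b₁′, 0)(z)` is constant on every horizontal plane ⇒ a periodic orbit is a straight line ⇒ stationary.  Hence, in the kernel (this file):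
    `noLoops_of_noIslands : NoIslands → NoLoops`   (mod the four PROVABLE/FACT stubs J, D, Z, Y),
    `frequencyGrowthExponent_iff_noIslands : ⟨27893⟩ ↔ NoIslands`   (⇒ = landed `zero_of_island`, no stub; ⇐ = the above + the vacuous
    NoLoops ⇒ ⟨27893⟩ of `noloops_wall`),
and the crux compositions BY NAME with the wall in its scalar form: 19708 / 20428 ⇐ S0 ∧ NoIslands ∧ HL3′ (`…_of_loopIsland`), plus the offer
22881 ⇐ NoIslands ∧ PeaklessLiouville.

WHY THIS LINE.  (i) It converts the wall of the THICK column from a statement about ORBITS of `ω` (period-growth exponents, closed vortex lines)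
into a statement about planar strict extrema of ONE SCALAR, the vertical velocity `w = v₂` restricted to horizontal planes: «for every non-zero
class e₃-poloidal profile, `±v₂(s,·)|_{P_z}` has no compact strict-extremal set, at any time, on any plane».  (ii) For `cdisprove-27893` the two
kernel-typed negation doors of the custody note (W_loop: exhibit a loop; W_peak: exhibit an island, via `zero_of_strictPlanarExtremum`) are ONE
door: a candidate profile is screened by a scalar criterion (a planar hill of `w`) instead of by integrating vortex lines.  (iii) Four stubs for K
hands, each unconditional: J (Jordan separation for `C¹` periodic orbits — classical FACT, typable as Literature), D (S/M: frozen law + extreme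
value + identity theorem), Z (M/L: persistence of a compact regular level circle), Y (M: harmonic Liouville per plane + straight-line orbits).
(iv) Barrier lens: every HL3-type kill so far needed a PINNED profile; this lever is pin-free and profile-wise, and it shows that «peakless»
(HL3′'s last binder) already FORCES «loop-free» — the residual world of the THICK column is exactly {pinned, thick, twisting, peakless ⇒ loop-free
⇒ (22880) ψ-extremum-free}: both Clebsch scalars `w` and `ψ` have trivial planar topology there.

WHY NOVEL vs the listed lines (INDEX-g6 + tree, searched `rg -n "Jordan|noIslands|NoIslands|peakless.*loop|loop.*peakless"` over
`Cruxes/PoloidalWindowRigidity`, `Cruxes/LrcModEntire`, `Theorems/LoopPeriodRatchet*`, `Theorems/PoloidalWindowDoor*HotLoop*`): hot_loops (LINE 13)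
and `…HotLoopsIslandOrNull/…HotLoop` go ISLAND ⇒ LOOP (trapping + first integral `±v₂`; K2-p2 records that the «inside/outside information of
Jordan type» for `ψ` is NOT available to that method); `LoopPeriodRatchet.NoPlanarExtremum` (22880, proved) goes ψ-EXTREMUM ⇒ LOOP.  Nobody has the
direction LOOP ⇒ (ISLAND ∨ FLAT PLANE) nor the flat-slab rigidity (Y); the equivalence ⟨27893⟩ ⟺ NoIslands is new in the tree.  Not a re-cut of HL3′
(HL3′ is untouched and still the residue), not a `𝒫_N = ∅` restatement (no pin anywhere), not thread_axis/centre_type (no thread, no centre type).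

DISPROOF USED (`Cruxes/PoloidalWindowRigidity/Disproof.lean` + negatives): honours «boundedness is load-bearing» (I8c always-poloidal unbounded
strain column: planes entirely `w`-flat WITH structure) — stub Y uses the class bounds on `v(s)` AND `Dv(s)` on all of `ℝ³`, and is false for
unbounded columns; honours I8a/I9 (no ratchet, no comparison of periods is used: the lever is TOPOLOGICAL + Liouville, time enters nowhere); no stub
is an instance of a landed Negative lemma (none concerns closed orbits / island brackets).  `_false_without_` obstructions of Disproof.lean concern
the (TH)/(THICK) local certificates (S0-side) and are not touched: S0 and HL3′ are carried VERBATIM.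

CHEAPEST FALSIFIER.  Of the lever: a `C²` bounded div-free e₃-poloidal field on `ℝ³` with bounded gradient, `∇ₕv₂ ≡ 0` on a slab, and a closed
vortex line in the slab — stub Y says none exists; by hand: `∇ₕw ≡ 0` on the slab does NOT propagate without analyticity, so the class-free version
of Y is FALSE (take `vₕ = ∇ₕΦ(x,y)χ(z)`-type fields with `w` repaired by `div`), which is why Y carries the class binders (analyticity in space at
fixed time, tree `analyticOnNhd_uncurry`).  Of stub Z: a degenerate closed orbit that disappears under change of plane — impossible for a REGULAR
compact level circle of the planar stream function (implicit function theorem); the stub asks `curl v(s) ≠ 0` at one point of the orbit, hence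
(flow-box/uniqueness) along all of it.  Of J: none (Jordan).  Of D: none (extreme value theorem).  INSTRUMENT ROW: none run (no numerics bear on a
topological lever; kit not used this generation).

BC7 probes (`#h21_crux_probe`, summit := `…PoloidalWindowDoor.PoloidalWindowRigidity` AND `…LoopPeriodRatchet.PlanarExtremumLiouville`) on
`NoIslands`, `stub_discDichotomy`, `stub_loopsPersist`, `stub_layeredNoLoop`, `stub_jordanOrbit`: see `Lines/loop_island.md` (verdicts pasted).
PROCESS (KEY-NS #68/#69): files only — no `skeleton check --crux`, no `propose`; the LEAD / K2 hands register or land what they choose.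
-/

open scoped InnerProductSpace RealInnerProductSpace Laplacian

-- the summit and its single sub-problem share the name (CONVENTIONS §1)
set_option linter.dupNamespace false

namespace Summit.NavierStokesRegularity.NavierStokesRegularity.Cruxes.PoloidalWindowRigidity.LoopIsland

open Set Function
open Literature.Analysis Literature.Analysis.FluidPDE
open Summit.NavierStokesRegularity.NavierStokesRegularity.Theses.LoopPeriodRatchet
open Summit.NavierStokesRegularity.NavierStokesRegularity.Theses.PoloidalWindowDoor
open Summit.NavierStokesRegularity.NavierStokesRegularity.Theorems

/-! ## The two readings of the wall -/

/-- **NoLoops** — VERBATIM the conclusion of `LoopPeriodRatchet.NoLoopsOfGrowth` (item 27894, proved from ⟨27893⟩): a class e₃-poloidal profile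
carries no non-stationary closed vortex line at any time `s < 0`.  `Lines/noloops_wall.lean`: ⟨27893⟩ ⟺ NoLoops (kernel). -/
def NoLoops : Prop :=
    ∀ (C : ℝ) (v : ℝ → EuclideanSpace ℝ (Fin 3) → EuclideanSpace ℝ (Fin 3)), Literature.Analysis.FluidPDE.HasTypeITimeDecay C v →
      ContinuousOn (Function.uncurry v) (Set.Iio (0 : ℝ) ×ˢ Set.univ) →
      (∀ s t : ℝ, s < t → t < 0 → ∀ x, v t x = Literature.Analysis.UnboundedOperators.heatExtension (v s) (t - s) x -
        Literature.Analysis.FluidPDE.oseenDuhamel 1 s v v t x) →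
      (∀ t < 0, Literature.Analysis.FluidPDE.VectorCalculus.IsDivFree (v t)) →
      (∀ s < 0, ∀ y, ⟪Literature.Analysis.FluidPDE.curl (v s) y, EuclideanSpace.single 2 1⟫_ℝ = 0) →
      ∀ s : ℝ, s < 0 → ∀ (γ : ℝ → EuclideanSpace ℝ (Fin 3)) (ℓ : ℝ), 0 < ℓ →
        (∀ θ, HasDerivAt γ (Literature.Analysis.FluidPDE.curl (v s) (γ θ)) θ) → (∀ θ, γ (θ + ℓ) = γ θ) →
        Literature.Analysis.FluidPDE.curl (v s) (γ 0) = 0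

/-- **NoIslands** — THE WALL IN SCALAR FORM: a class e₃-poloidal profile with an ISLAND BRACKET (`σ = ±1`, a compact nonempty `K ⊂ {y₂ = z₁}` on
which `σv₂(s₀,·) = M`, an open guard `O ⊇ K` with `σv₂(s₀,·) ≤ M` on `O ∩ {y₂ = z₁}` and every level-`M` point of `O ∩ {y₂ = z₁}` in `K`) is
identically zero.  VERBATIM the statement of the landed `…HotLoopsReduction.zero_of_island` with its wall hypothesis removed. -/
def NoIslands : Prop :=
    ∀ (C : ℝ) (v : ℝ → EuclideanSpace ℝ (Fin 3) → EuclideanSpace ℝ (Fin 3)),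
      Literature.Analysis.FluidPDE.HasTypeITimeDecay C v →
      ContinuousOn (Function.uncurry v) (Set.Iio (0 : ℝ) ×ˢ Set.univ) →
      (∀ s t : ℝ, s < t → t < 0 → ∀ x, v t x =
        Literature.Analysis.UnboundedOperators.heatExtension (v s) (t - s) x -
          Literature.Analysis.FluidPDE.oseenDuhamel 1 s v v t x) →
      (∀ t < 0, Literature.Analysis.FluidPDE.VectorCalculus.IsDivFree (v t)) →
      (∀ s < 0, ∀ y, ⟪Literature.Analysis.FluidPDE.curl (v s) y, EuclideanSpace.single 2 1⟫_ℝ = 0) →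
      ∀ (s₀ z₁ σ M : ℝ) (K O : Set (EuclideanSpace ℝ (Fin 3))), s₀ < 0 →
        ((σ = 1 ∨ σ = -1) ∧ IsCompact K ∧ K.Nonempty ∧ (∀ y ∈ K, y 2 = z₁ ∧ σ * v s₀ y 2 = M) ∧
          IsOpen O ∧ K ⊆ O ∧ (∀ y ∈ O, y 2 = z₁ → σ * v s₀ y 2 ≤ M) ∧
          (∀ y ∈ O, y 2 = z₁ → σ * v s₀ y 2 = M → y ∈ K)) →
        ∀ t < 0, ∀ x, v t x = 0

/-! ## Own stubs: J (fact), D, Z, Y (provable) -/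

/-- **STUB J (`stub_jordanOrbit`) — JORDAN SEPARATION for a periodic orbit of a horizontal `C¹` field.**  A non-stationary `ℓ`-periodic orbit `γ`
of a `C¹` field `X` on `ℝ³` with `X₂ ≡ 0` runs in the plane `P = {y₂ = (γ 0)₂}` and is a `C¹` simple closed curve there (uniqueness of solutions;
`X ≠ 0` along it); its planar complement has a BOUNDED component.  Typed as what the line consumes: an open bounded `O ⊂ ℝ³` meeting `P`, whose
closure meets `P ∖ O` only inside `range γ` (e.g. the cylinder over the Jordan interior).  Classical FACT [Jordan 1887; Veblen, Trans. AMS 6 (1905)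
83–98; for `C¹` curves via the winding number: do Carmo, Differential Geometry of Curves and Surfaces §5-7]; Mathlib has no Jordan curve theorem
(`lean search 'Jordan' --decl`: none) — provable in the tree from the winding number of a `C¹` loop (L) or filed as a Literature fact.
Why it might fail: it cannot (theorem); the risk is cost. -/
theorem stub_jordanOrbit :
    ∀ (X : EuclideanSpace ℝ (Fin 3) → EuclideanSpace ℝ (Fin 3)), ContDiff ℝ 1 X → (∀ y, X y 2 = 0) →
      ∀ (γ : ℝ → EuclideanSpace ℝ (Fin 3)) (ℓ : ℝ), 0 < ℓ → (∀ θ, HasDerivAt γ (X (γ θ)) θ) → (∀ θ, γ (θ + ℓ) = γ θ) →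
        X (γ 0) ≠ 0 →
        ∃ O : Set (EuclideanSpace ℝ (Fin 3)), IsOpen O ∧ Bornology.IsBounded O ∧ (∃ y ∈ O, y 2 = γ 0 2) ∧
          ∀ y ∈ closure O, y 2 = γ 0 2 → y ∉ O → y ∈ Set.range γ := by
  sorry

/-- **STUB D (`stub_discDichotomy`) — ISLAND OR FLAT PLANE.**  Class e₃-poloidal profile, time `s < 0`, a non-stationary closed vortex line `γ`
and a Jordan region `O` for it (the conclusion of J).  The frozen law (`⟪Dv(s)·curl v(s), e₃⟫ = 0`, tree `…FirstIntegral` / `…HotLoop` `hfrozen`)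
makes `w := v₂(s,·)` constant `= c` on `range γ`; `D̄ := closure O ∩ P` is compact and nonempty.  EITHER `w ≠ c` somewhere on `O ∩ P` — then with
`σ := sign`, `M := max_{D̄} σw > σc`, `K := {σw = M} ∩ D̄` (compact, nonempty, `⊆ O` because `D̄ ∖ O ⊆ range γ` where `σw = σc < M`) and guard `O`
the data `(σ, M, K, O)` ARE an island bracket at `(s, (γ 0)₂)` — OR `w ≡ c` on the relatively open nonempty `O ∩ P`, hence on all of `P` (the slice
`v(s,·)` is real-analytic, tree `analyticOnNhd_uncurry`; identity theorem on the connected plane).  Provable (S/M).  Why it might fail: it cannot as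
stated (extreme value theorem + identity theorem); cost only. -/
theorem stub_discDichotomy :
    ∀ (C : ℝ) (v : ℝ → EuclideanSpace ℝ (Fin 3) → EuclideanSpace ℝ (Fin 3)),
      Literature.Analysis.FluidPDE.HasTypeITimeDecay C v →
      ContinuousOn (Function.uncurry v) (Set.Iio (0 : ℝ) ×ˢ Set.univ) →
      (∀ s t : ℝ, s < t → t < 0 → ∀ x, v t x =
        Literature.Analysis.UnboundedOperators.heatExtension (v s) (t - s) x -
          Literature.Analysis.FluidPDE.oseenDuhamel 1 s v v t x) →
      (∀ t < 0, Literature.Analysis.FluidPDE.VectorCalculus.IsDivFree (v t)) →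
      (∀ s < 0, ∀ y, ⟪Literature.Analysis.FluidPDE.curl (v s) y, EuclideanSpace.single 2 1⟫_ℝ = 0) →
      ∀ s : ℝ, s < 0 → ∀ (γ : ℝ → EuclideanSpace ℝ (Fin 3)) (ℓ : ℝ), 0 < ℓ →
        (∀ θ, HasDerivAt γ (Literature.Analysis.FluidPDE.curl (v s) (γ θ)) θ) → (∀ θ, γ (θ + ℓ) = γ θ) →
        Literature.Analysis.FluidPDE.curl (v s) (γ 0) ≠ 0 →
        ∀ O : Set (EuclideanSpace ℝ (Fin 3)), IsOpen O → Bornology.IsBounded O → (∃ y ∈ O, y 2 = γ 0 2) →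
          (∀ y ∈ closure O, y 2 = γ 0 2 → y ∉ O → y ∈ Set.range γ) →
          (∃ (σ M : ℝ) (K O' : Set (EuclideanSpace ℝ (Fin 3))),
              (σ = 1 ∨ σ = -1) ∧ IsCompact K ∧ K.Nonempty ∧ (∀ y ∈ K, y 2 = γ 0 2 ∧ σ * v s y 2 = M) ∧
                IsOpen O' ∧ K ⊆ O' ∧ (∀ y ∈ O', y 2 = γ 0 2 → σ * v s y 2 ≤ M) ∧
                (∀ y ∈ O', y 2 = γ 0 2 → σ * v s y 2 = M → y ∈ K)) ∨
            (∀ y : EuclideanSpace ℝ (Fin 3), y 2 = γ 0 2 → v s y 2 = v s (γ 0) 2) := by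
  sorry

/-- **STUB Z (`stub_loopsPersist`) — CLOSED VORTEX LINES PERSIST ACROSS NEARBY PLANES (same time).**  On each plane `P_z` the field
`X_z := curl v(s)|_{P_z}` is horizontal and planar-divergence-free (`∂ₓω₁ + ∂_yω₂ = −∂_zω₃ = 0`), with stream function `Ψ_z` depending `C²` on
`z`; a non-stationary closed orbit in `P_{z₀}` is a compact REGULAR component of a level set of `Ψ_{z₀}`, which survives as a compact regular level
circle `Λ_z` of `Ψ_z` for `|z − z₀| < δ` (implicit function theorem along the normals + compactness), and a trajectory confined to `Λ_z` with
speed `≥ m > 0` is periodic.  Provable (M/L: tubular coordinates, or a Poincaré return map on a transversal).  Why it might fail: it cannot for a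
REGULAR orbit (`curl v(s) ≠ 0` at one point ⇒ along the whole orbit by uniqueness); cost only. -/
theorem stub_loopsPersist :
    ∀ (C : ℝ) (v : ℝ → EuclideanSpace ℝ (Fin 3) → EuclideanSpace ℝ (Fin 3)),
      Literature.Analysis.FluidPDE.HasTypeITimeDecay C v →
      ContinuousOn (Function.uncurry v) (Set.Iio (0 : ℝ) ×ˢ Set.univ) →
      (∀ s t : ℝ, s < t → t < 0 → ∀ x, v t x =
        Literature.Analysis.UnboundedOperators.heatExtension (v s) (t - s) x -
          Literature.Analysis.FluidPDE.oseenDuhamel 1 s v v t x) →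
      (∀ t < 0, Literature.Analysis.FluidPDE.VectorCalculus.IsDivFree (v t)) →
      (∀ s < 0, ∀ y, ⟪Literature.Analysis.FluidPDE.curl (v s) y, EuclideanSpace.single 2 1⟫_ℝ = 0) →
      ∀ s : ℝ, s < 0 → ∀ (γ : ℝ → EuclideanSpace ℝ (Fin 3)) (ℓ : ℝ), 0 < ℓ →
        (∀ θ, HasDerivAt γ (Literature.Analysis.FluidPDE.curl (v s) (γ θ)) θ) → (∀ θ, γ (θ + ℓ) = γ θ) →
        Literature.Analysis.FluidPDE.curl (v s) (γ 0) ≠ 0 →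
        ∃ δ : ℝ, 0 < δ ∧ ∀ z : ℝ, |z - γ 0 2| < δ →
          ∃ (γ' : ℝ → EuclideanSpace ℝ (Fin 3)) (ℓ' : ℝ), 0 < ℓ' ∧
            (∀ θ, HasDerivAt γ' (Literature.Analysis.FluidPDE.curl (v s) (γ' θ)) θ) ∧ (∀ θ, γ' (θ + ℓ') = γ' θ) ∧
            γ' 0 2 = z ∧ Literature.Analysis.FluidPDE.curl (v s) (γ' 0) ≠ 0 := by
  sorry

/-- **STUB Y (`stub_layeredNoLoop`) — A `w`-FLAT SLAB MAKES THE SLICE LAYERED, AND LAYERED SLICES CARRY NO LOOPS.**  If `v₂(s,·)` is constant on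
every horizontal plane of a slab `|z − z₀| < δ`, then `∇ₕv₂(s,·) ≡ 0` on the open slab, hence on `ℝ³` (the slice is real-analytic); with
`curl_z v = 0` and `div v = 0` each `vₕ(s,·,z)` is a planar harmonic gradient whose derivative `∇ₕvₕ` is bounded and harmonic ⇒ constant (Liouville,
tree `isConst_of_harmonic_bounded_inner`-type) ⇒ `vₕ` affine and bounded ⇒ `vₕ(s,·,z) = b(z)`; then `curl v(s) = (−b₂′(z), b₁′(z), 0)` is constant
on each horizontal plane, an orbit is `θ ↦ γ 0 + θκ`, and periodicity forces `κ = 0`.  Uses the class bounds on `v(s)` and `Dv(s)` on ALL of `ℝ³`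
(honours I8c: false for unbounded columns).  Provable (M).  Why it might fail: it cannot in the class; without boundedness of `Dv` or analyticity
it is false (cost/book-keeping only). -/
theorem stub_layeredNoLoop :
    ∀ (C : ℝ) (v : ℝ → EuclideanSpace ℝ (Fin 3) → EuclideanSpace ℝ (Fin 3)),
      Literature.Analysis.FluidPDE.HasTypeITimeDecay C v →
      ContinuousOn (Function.uncurry v) (Set.Iio (0 : ℝ) ×ˢ Set.univ) →
      (∀ s t : ℝ, s < t → t < 0 → ∀ x, v t x =
        Literature.Analysis.UnboundedOperators.heatExtension (v s) (t - s) x -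
          Literature.Analysis.FluidPDE.oseenDuhamel 1 s v v t x) →
      (∀ t < 0, Literature.Analysis.FluidPDE.VectorCalculus.IsDivFree (v t)) →
      (∀ s < 0, ∀ y, ⟪Literature.Analysis.FluidPDE.curl (v s) y, EuclideanSpace.single 2 1⟫_ℝ = 0) →
      ∀ s : ℝ, s < 0 →
        (∃ z₀ δ : ℝ, 0 < δ ∧ ∀ z : ℝ, |z - z₀| < δ → ∃ c : ℝ, ∀ y : EuclideanSpace ℝ (Fin 3), y 2 = z → v s y 2 = c) →
        ∀ (γ : ℝ → EuclideanSpace ℝ (Fin 3)) (ℓ : ℝ), 0 < ℓ →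
          (∀ θ, HasDerivAt γ (Literature.Analysis.FluidPDE.curl (v s) (γ θ)) θ) → (∀ θ, γ (θ + ℓ) = γ θ) →
          Literature.Analysis.FluidPDE.curl (v s) (γ 0) = 0 := by
  sorry

/-! ## Kernel: NoIslands ⇒ NoLoops, and ⟨27893⟩ ⟺ NoIslands -/

/-- **PEAKLESS ⇒ LOOP-FREE (the lever, composed).**  Given a non-stationary closed vortex line at `(s, z₀)`: Z gives loops on every plane of a slab;
on each of them J + D give an island bracket — killed by `NoIslands` (`v ≡ 0` contradicts the loop) — or a `w`-flat plane; so the slab is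
`w`-flat and Y makes the original loop stationary.  Kernel-checked modulo the stubs J, D, Z, Y. -/
theorem noLoops_of_noIslands (hNI : NoIslands) : NoLoops := by
  intro C v hrate hcont hmild hdiv hpol s hs γ ℓ hℓ hγ hper
  by_contra hne
  obtain ⟨δ, hδ, hZ⟩ := stub_loopsPersist C v hrate hcont hmild hdiv hpol s hs γ ℓ hℓ hγ hper hne
  -- `C¹`-regularity and horizontality of `curl v(s)` (tree: the route class is Type-I ancient mild; slices are smooth)
  have hA : IsTypeIAncientMild C v :=
    PoloidalWindowDoorPoloidalWindowRigidityWindow.isTypeIAncientMild_of_class hrate hcont hmild hdiv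
  have hvs : ContDiff ℝ (⊤ : ℕ∞) (v s) := hA.contDiff_slice hs
  have hV2 : ContDiff ℝ 2 (v s) := contDiff_infty.1 hvs 2
  have hX : ContDiff ℝ 1 (curl (v s)) := contDiff_curl (n := 1) (by exact_mod_cast hV2)
  have hX2 : ∀ y, curl (v s) y 2 = 0 := fun y => by
    simpa [EuclideanSpace.inner_single_right] using hpol s hs y
  have hflat : ∀ z : ℝ, |z - γ 0 2| < δ → ∃ c : ℝ, ∀ y : EuclideanSpace ℝ (Fin 3), y 2 = z → v s y 2 = c := by
    intro z hz
    obtain ⟨γ', ℓ', hℓ', hγ', hper', hz', hne'⟩ := hZ z hz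
    obtain ⟨O, hO, hbdd, hneO, hfr⟩ := stub_jordanOrbit (curl (v s)) hX hX2 γ' ℓ' hℓ' hγ' hper' hne'
    rcases stub_discDichotomy C v hrate hcont hmild hdiv hpol s hs γ' ℓ' hℓ' hγ' hper' hne' O hO hbdd hneO hfr with
      ⟨σ, M, K, O', hisl⟩ | hconst
    · exfalso
      have hzero := hNI C v hrate hcont hmild hdiv hpol s (γ' 0 2) σ M K O' hs hisl
      have hvs0 : v s = 0 := by
        funext x
        exact hzero s hs x
      apply hne'
      rw [hvs0]
      exact curl_zero _
    · exact ⟨v s (γ' 0) 2, fun y hy => hconst y (by rw [hy, hz'])⟩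
  exact hne (stub_layeredNoLoop C v hrate hcont hmild hdiv hpol s hs ⟨γ 0 2, δ, hδ, hflat⟩ γ ℓ hℓ hγ hper)

/-- NoLoops ⇒ ⟨27893⟩ (vacuous direction, as in `Lines/noloops_wall.lean`: `A := 1`, `κ := 0`). No stub. -/
theorem frequencyGrowthExponent_of_noLoops (h : NoLoops) : FrequencyGrowthExponent := by
  intro C v hd hc hm hdf hpol
  refine ⟨1, 0, one_pos, by norm_num, ?_⟩
  intro t₀ t _ht₀ ht c T hT hper hder hne
  obtain ⟨s₀, hs₀⟩ := hne
  exfalso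
  apply hs₀
  have key := h C v hd hc hm hdf hpol t ht (fun θ => c (θ + s₀)) T hT
    (fun θ => (hder (θ + s₀)).comp_add_const θ s₀)
    (fun θ => by
      show c (θ + T + s₀) = c (θ + s₀)
      rw [add_right_comm]
      exact hper (θ + s₀))
  simpa using key

/-- ⟨27893⟩ ⇒ NoIslands — this IS the landed `…HotLoopsReduction.zero_of_island` (K2-p2 p666322; HP1/HP3′/HP4″ landed). No stub. -/
theorem noIslands_of_frequencyGrowthExponent (hG : FrequencyGrowthExponent) : NoIslands :=
  PoloidalWindowDoorPoloidalWindowRigidityHotLoopsReduction.zero_of_island hG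

/-- NoIslands ⇒ ⟨27893⟩ (mod J, D, Z, Y). -/
theorem frequencyGrowthExponent_of_noIslands (hNI : NoIslands) : FrequencyGrowthExponent :=
  frequencyGrowthExponent_of_noLoops (noLoops_of_noIslands hNI)

/-- **THE WALL IS A SCALAR WALL: ⟨27893⟩ `FrequencyGrowthExponent` ⟺ NoIslands** (mod the provable/fact stubs J, D, Z, Y; the direction ⇒ uses
no stub). -/
theorem frequencyGrowthExponent_iff_noIslands : FrequencyGrowthExponent ↔ NoIslands :=
  ⟨noIslands_of_frequencyGrowthExponent, frequencyGrowthExponent_of_noIslands⟩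

/-- NoLoops ⟺ NoIslands (mod J, D, Z, Y): per class poloidal profile, closed vortex lines and planar hills of `v₂` come together. -/
theorem noLoops_iff_noIslands : NoLoops ↔ NoIslands :=
  ⟨fun h => noIslands_of_frequencyGrowthExponent (frequencyGrowthExponent_of_noLoops h), noLoops_of_noIslands⟩

/-! ## Shared stubs (verbatim) and THE WALL in scalar form -/

/-- **THE WALL, scalar form (`stub_noIslands`).**  ≡ item stmt-NavierStokesRegularity-27893 by `frequencyGrowthExponent_iff_noIslands`.  OPEN;
research; nothing about it is claimed here.  Why it might fail: it is ⟨27893⟩ — any non-zero class e₃-poloidal Type-I ancient profile with a planar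
hill of `v₂` refutes it (none is known; `cdisprove-27893` hunts one). -/
theorem stub_noIslands : NoIslands := by
  sorry

/-- **SHARED STUB S0 ((TH) column) — VERBATIM `stub_localTHEmptyHypNUGRS`** of `Cruxes/LrcModEntire/Lines/twist_split.lean` (item 20428's skeleton
of record) = hot_loops v4.3's copy.  One landing closes it here and there. -/
theorem stub_localTHEmptyHypNUGRS :
    ∀ (u : ℝ → EuclideanSpace ℝ (Fin 3) → EuclideanSpace ℝ (Fin 3)) (μ A : ℝ → ℝ → ℝ)
      (U : Set (ℝ × EuclideanSpace ℝ (Fin 3))) (p₀ : ℝ × EuclideanSpace ℝ (Fin 3)),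
      IsOpen U → p₀ ∈ U →
      AnalyticOnNhd ℝ (Function.uncurry u) U →
      (∀ p ∈ U, AnalyticAt ℝ (Function.uncurry μ) (p.1, p.2 2)) →
      (∀ p ∈ U, AnalyticAt ℝ (Function.uncurry A) (p.1, p.2 2)) →
      (∀ p ∈ U, fderiv ℝ (u p.1) p.2 (EuclideanSpace.single 0 1) 1 = fderiv ℝ (u p.1) p.2 (EuclideanSpace.single 1 1) 0) →
      (∀ p ∈ U, fderiv ℝ (u p.1) p.2 (EuclideanSpace.single 0 1) 0 + fderiv ℝ (u p.1) p.2 (EuclideanSpace.single 1 1) 1 +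
        fderiv ℝ (u p.1) p.2 (EuclideanSpace.single 2 1) 2 = 0) →
      (∀ p ∈ U, ∀ b : Fin 3, b ≠ 2 →
        fderiv ℝ (u p.1) p.2 (EuclideanSpace.single 2 1) b =
          μ p.1 (p.2 2) * fderiv ℝ (u p.1) p.2 (EuclideanSpace.single b 1) 2) →
      (∀ p ∈ U,
        (1 - μ p.1 (p.2 2)) *
            (deriv (fun s => u s p.2 2) p.1 + fderiv ℝ (fun y => u p.1 y 2) p.2 (u p.1 p.2)
              - Δ (fun y => u p.1 y 2) p.2) =
          A p.1 (p.2 2) + (deriv (fun s => μ s (p.2 2)) p.1 - deriv (deriv (μ p.1)) (p.2 2)) * u p.1 p.2 2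
            + deriv (μ p.1) (p.2 2) / 2 * u p.1 p.2 2 ^ 2
            - 2 * deriv (μ p.1) (p.2 2) * fderiv ℝ (u p.1) p.2 (EuclideanSpace.single 2 1) 2) →
      fderiv ℝ (fun y => fderiv ℝ (u p₀.1) y (EuclideanSpace.single 2 1) 2) p₀.2 (EuclideanSpace.single 0 1) *
            fderiv ℝ (u p₀.1) p₀.2 (EuclideanSpace.single 1 1) 2 -
          fderiv ℝ (fun y => fderiv ℝ (u p₀.1) y (EuclideanSpace.single 2 1) 2) p₀.2 (EuclideanSpace.single 1 1) *
            fderiv ℝ (u p₀.1) p₀.2 (EuclideanSpace.single 0 1) 2 ≠ 0 →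
      μ p₀.1 (p₀.2 2) ≠ 0 → μ p₀.1 (p₀.2 2) ≠ 1 → deriv (μ p₀.1) (p₀.2 2) ≠ 0 →
      μ p₀.1 (p₀.2 2) < 0 →
      (fderiv ℝ (u p₀.1) p₀.2 (EuclideanSpace.single 0 1) 0 ≠ fderiv ℝ (u p₀.1) p₀.2 (EuclideanSpace.single 1 1) 1 ∨
        fderiv ℝ (u p₀.1) p₀.2 (EuclideanSpace.single 1 1) 0 ≠ 0) →
      u p₀.1 p₀.2 = 0 → 
      fderiv ℝ (u p₀.1) p₀.2 (EuclideanSpace.single 0 1) 2 = 0 →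
      fderiv ℝ (u p₀.1) p₀.2 (EuclideanSpace.single 1 1) 2 = 1 → False := by
  sorry

/-- **SHARED STUB HL3′ (`stub_peaklessEmpty`) — VERBATIM hot_loops v4.3** (census `Lines/hot_loops-HL3-census.md`): the pinned, thick, twisting,
PEAKLESS profile does not exist.  The residue of the THICK column; OPEN; research.  By `noLoops_of_noIslands` applied profile-wise, a peakless
profile is automatically loop-free and (22880) ψ-extremum-free — recorded, not used. -/
theorem stub_peaklessEmpty :
    ∀ (C : ℝ) (v : ℝ → EuclideanSpace ℝ (Fin 3) → EuclideanSpace ℝ (Fin 3)),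
      Literature.Analysis.FluidPDE.HasTypeITimeDecay C v →
      ContinuousOn (Function.uncurry v) (Set.Iio (0 : ℝ) ×ˢ Set.univ) →
      (∀ s t : ℝ, s < t → t < 0 → ∀ x, v t x =
        Literature.Analysis.UnboundedOperators.heatExtension (v s) (t - s) x -
          Literature.Analysis.FluidPDE.oseenDuhamel 1 s v v t x) →
      (∀ t < 0, Literature.Analysis.FluidPDE.VectorCalculus.IsDivFree (v t)) →
      (∀ s < 0, ∀ y, ⟪Literature.Analysis.FluidPDE.curl (v s) y, EuclideanSpace.single 2 1⟫_ℝ = 0) →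
      v (-1) 0 2 ≠ 0 → (∀ t < 0, ∀ x, Real.sqrt (-t) * |v t x 2| ≤ |v (-1) 0 2|) →
      (∀ h : EuclideanSpace ℝ (Fin 3), fderiv ℝ (v (-1)) 0 h 2 = 0) →
      (deriv (fun s => v s 0 2) (-1) = v (-1) 0 2 / 2 ∧ v (-1) 0 2 * (Δ (fun y => v (-1) y 2)) 0 ≤ 0) →
      ∀ W : Set (ℝ × EuclideanSpace ℝ (Fin 3)), IsOpen W → W ⊆ Set.Iio (0 : ℝ) ×ˢ Set.univ →
        (∀ z ∈ W, (Literature.Analysis.FluidPDE.curl (v z.1) z.2 ≠ 0 ∧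
            (fderiv ℝ (v z.1) z.2 (EuclideanSpace.single 0 1) 2 ≠ 0 ∨ fderiv ℝ (v z.1) z.2 (EuclideanSpace.single 1 1) 2 ≠ 0) ∧
            (fderiv ℝ (v z.1) z.2 (EuclideanSpace.single 2 1) 0 ≠ 0 ∨ fderiv ℝ (v z.1) z.2 (EuclideanSpace.single 2 1) 1 ≠ 0)) ∧
          (fderiv ℝ (fun x => fderiv ℝ (v z.1) x (EuclideanSpace.single 2 1) 2) z.2 (EuclideanSpace.single 0 1) *
                fderiv ℝ (v z.1) z.2 (EuclideanSpace.single 1 1) 2 -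
              fderiv ℝ (fun x => fderiv ℝ (v z.1) x (EuclideanSpace.single 2 1) 2) z.2 (EuclideanSpace.single 1 1) *
                fderiv ℝ (v z.1) z.2 (EuclideanSpace.single 0 1) 2 ≠ 0)) →
        (∀ m : ℝ → ℝ → ℝ, ∀ W₁ : Set (ℝ × EuclideanSpace ℝ (Fin 3)), W₁ ⊆ W → IsOpen W₁ → W₁.Nonempty →
            ∃ z ∈ W₁, ∃ b : Fin 3, b ≠ 2 ∧
              fderiv ℝ (v z.1) z.2 (EuclideanSpace.single 2 1) b ≠
                m z.1 (z.2 2) * fderiv ℝ (v z.1) z.2 (EuclideanSpace.single b 1) 2) →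
        (∀ r : ℝ, 0 < r → (Metric.ball ((-1 : ℝ), (0 : EuclideanSpace ℝ (Fin 3))) r ∩ W).Nonempty) →
        (∀ (s z₀ σ M : ℝ) (K O : Set (EuclideanSpace ℝ (Fin 3))), s < 0 →
          ((σ = 1 ∨ σ = -1) ∧ IsCompact K ∧ K.Nonempty ∧ (∀ y ∈ K, y 2 = z₀ ∧ σ * v s y 2 = M) ∧
            IsOpen O ∧ K ⊆ O ∧ (∀ y ∈ O, y 2 = z₀ → σ * v s y 2 ≤ M) ∧
            (∀ y ∈ O, y 2 = z₀ → σ * v s y 2 = M → y ∈ K)) → False) →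
        False := by
  sorry

/-! ## Compositions to the crux items BY NAME (through the landed `…HotLoopsReduction`) -/

/-- **The crux `PoloidalWindowRigidity` (K2, stmt-NavierStokesRegularity-19708) BY NAME ⇐ S0 ∧ NoIslands ∧ HL3′** (+ J, D, Z, Y): tree
`…HotLoopsReduction.poloidalWindowRigidity_of_NUGRS_of_growth_of_peakless` with the wall supplied in scalar form through
`frequencyGrowthExponent_of_noIslands`.  CONDITIONAL; no summit is proved. -/
theorem PoloidalWindowRigidity_of_loopIsland :
    Summit.NavierStokesRegularity.NavierStokesRegularity.Theses.PoloidalWindowDoor.PoloidalWindowRigidity :=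
  PoloidalWindowDoorPoloidalWindowRigidityHotLoopsReduction.poloidalWindowRigidity_of_NUGRS_of_growth_of_peakless
    stub_localTHEmptyHypNUGRS (frequencyGrowthExponent_of_noIslands stub_noIslands) stub_peaklessEmpty

/-- **The item `LrcModEntire` (stmt-NavierStokesRegularity-20428) BY NAME ⇐ S0 ∧ NoIslands ∧ HL3′** (+ J, D, Z, Y). CONDITIONAL. -/
theorem LrcModEntire_of_loopIsland :
    Summit.NavierStokesRegularity.NavierStokesRegularity.Theses.PoloidalWindowDoor.LrcModEntire :=
  PoloidalWindowDoorPoloidalWindowRigidityHotLoopsReduction.lrcModEntire_of_NUGRS_of_growth_of_peakless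
    stub_localTHEmptyHypNUGRS (frequencyGrowthExponent_of_noIslands stub_noIslands) stub_peaklessEmpty

end Summit.NavierStokesRegularity.NavierStokesRegularity.Cruxes.PoloidalWindowRigidity.LoopIsland
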